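import Summits.CriticalPhenomena.PercolationContinuityZ3.Theorems.PercNearOneGluingNoHeavyQuantAD3FourAtomLaws
import Summits.CriticalPhenomena.PercolationContinuityZ3.Theorems.PercNearOneGluingNoHeavyQuantCornerPrefix
import HarnessLib

/-!
# QUANT lane R8, T-DEC, ROUTE 2: the ADMISSIBILITY OF A FOUR-ATOM LAW WITH A ZERO ATOM IS ONE LINEAR INEQUALITY —
# sufficiency half (explicit flows at every layer)

builds on p205010 (kernel theorem, internal audit signed; external expert review pending)

Support file (`--supports stmt-CriticalPhenomena-4575`), QUANT lane, seat prim-quant-arm-2 (gen 37), rung R8 of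
`run/shared/lean/prim/quant/LADDER.md`; second kernel piece (after `…QuantAD3FourAtomLaws`) of the proof that the Route-2 gate cell
`LawDec.AD3GateTriple4` (typer g31, `…QuantAD3GateCellReduction`) holds.  Memo
`run/shared/lean/prim/quant/prim-quant-arm-2-g37/AD3-GATE4-G37.md`.  Theorems only, standard axioms, no sorries, no definitions.

THE SETTING.  A law `L` on four atoms `0 < a < b < c ≤ M` with masses `Z, A, B, C ≥ 0` (`Z + A + B + C = 1`), mean
`T = aA + bB + cC`, at a floor `0 < y < 1` that is TOP-AFFORDABLE, `y·M ≤ T`.  (In the gate cell, `L = gate_q ν` for the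
4-atom law `ν = gate_{q₀}{s₁, s₂, s₃}`; the gate only changes the masses, so `q` does not appear here.)  The question is
when `L` is `DECAt y j′ M` at EVERY layer `j′ < M`.

THE ANSWER (this file: ⟸; `…QuantAD3FourAtomDual`: ⟹).  Only the layers `a ≤ j′ < c` can bind: below `a` the only low
is `0` and every other atom is a giant (criterion E from the mean); at and above `c` every atom sits at or below the layer and
Theorem A (`decAt_of_top_le`, `y·c ≤ T`) applies.  If `2a ≥ T` the only low anywhere is `0` and the first-moment criterion
gives every layer (`fourAtom_decAt_of_bigLow`).  If `2a < T`:
* layers `a ≤ j′ < b` (lows `0, a`; giants `b, c`): `y ≤ B + C`                                               (H1);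
* layers `b ≤ j′ < c` (`c` a giant, `b` a mid):
  (i)  `2b < T` (three lows): `y ≤ C`                                                                            (H2);
  (ii) `a + b ≤ T ≤ 2b` (`b` self-sufficient, incompatible with both lows): `y(Z + A) ≤ (1−y)C`                  (H3);
  (iii) `T < a + b`: the corner flow — `a` rides `b` at its minimal gate `g = pairGate y T a b` (usage `r = g/(1−g)`), the
  overflow of `a` and all of `0` ride the giant `c`; if `a` FITS into `b` (`rA ≤ B`) the remainder has only the low `0` and
  satisfies the first-moment criterion AUTOMATICALLY (`usage_mid_mul_le`: `r(b−T) ≤ T − a`); if `a` OVERFLOWS, the giant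
  must carry `Z + A − B/r`, i.e. `y·g·(Z + A) ≤ y(1−g)B + (1−y)gC`                                            (C1).
So admissibility at all layers follows from H1 ∧ [H2 | H3 | C1] by regime (`fourAtom_decAt_all_of_*`).  The companion file
shows these are also NECESSARY, so the admissible set is the mean polygon cut by ONE half-plane — whence every admissible
4-atom law with a zero atom is AD3⁺ (`…QuantAD3FourAtom`), and the gate cell.

EXACT EVIDENCE (arm-2 g37, own engine `work/ad3/`, independent of lead g31's lib): the characterisation was checked on
156 190 random mean-`T` laws on `{0,a,b,c}` (2 861 of them inadmissible), the admissible polygon was computed exactly by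
cutting planes for ≈ 5 000 parameter sets (0 interior vertices), and the cell census is 62 500 / 0.

* (`…QuantAD3FourAtomLaws`: bookkeeping, layers `j′ < b` from H1, layers `c ≤ j′`, mid layers from H2 / H3.)
* `LawDec.fourAtom_partial_remainder`, `fourAtom_decAt_mid_fits` (unconditional), `fourAtom_decAt_mid_overflow` (C1) — the corner layers.
* **`LawDec.fourAtom_decAt_of_bigLow`**, **`fourAtom_decAt_all_of_threeLows`**, **`fourAtom_decAt_all_of_incompatible`**,
  **`fourAtom_decAt_all_of_corner`** — DEC at every layer `j′ < M`, by regime.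

[this work]; flow normal form / rates / Theorem A: this lane (typer g22–g26, lead g21–g22, census-2 g50).  The gluing rows served
[cite: KozmaNitzan2024, Conjecture 3 (p. 15)]; product measure [cite: Grimmett1999, §1.3 p. 10].
-/

noncomputable section

namespace Summit.CriticalPhenomena.PercolationContinuityZ3.Theorems

namespace Quant

open Finset

/-- four-atom law notation `QD[a, b, c, Z, A, B, C, h] = Z·[h = 0] + A·[h = a] + B·[h = b] + C·[h = c]`. -/
local notation3 "QD[" a ", " b ", " c ", " Z ", " A ", " B ", " C ", " h "]" =>
  (Z : ℝ) * (if (h : ℕ) = (0 : ℕ) then (1 : ℝ) else 0) + (A : ℝ) * (if (h : ℕ) = (a : ℕ) then (1 : ℝ) else 0)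
    + (B : ℝ) * (if (h : ℕ) = (b : ℕ) then (1 : ℝ) else 0) + (C : ℝ) * (if (h : ℕ) = (c : ℕ) then (1 : ℝ) else 0)

namespace LawDec

/-! ### The corner layers `b ≤ j′ < c` when `T < a + b`: partial flow of `a` into `b` -/

/-- the remainder after shipping `m` units of the low `a` into the mid `b` (a single-arc partial flow) is the four-atom law with
masses `(Z, A − m, B − usage(a,b)·m, C)`. [this work] -/
theorem fourAtom_partial_remainder (y T : ℝ) (j' M a b c : ℕ) (Z A B C m : ℝ) (haj : a ≤ j') (hbM : b ≤ M) :
    (fun t => QD[a, b, c, Z, A, B, C, t] - ∑ h ∈ Finset.range (M + 1), (if t = a ∧ h = b then m else 0)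
        - ∑ l ∈ Finset.range (j' + 1), usage y T j' l t * (if l = a ∧ t = b then m else 0))
      = fun t => QD[a, b, c, Z, A - m, B - usage y T j' a b * m, C, t] := by
  funext t
  have e1 : ∑ h ∈ Finset.range (M + 1), (if t = a ∧ h = b then m else (0 : ℝ)) = if t = a then m else 0 := by
    by_cases hta : t = a
    · rw [if_pos hta]
      have e : ∀ h : ℕ, (if t = a ∧ h = b then m else (0 : ℝ)) = if h = b then m else 0 := fun h => by
        simp only [hta, true_and]
      simp_rw [e]
      rw [Finset.sum_ite_eq' (Finset.range (M + 1)) b, if_pos (Finset.mem_range.2 (by omega))]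
    · rw [if_neg hta]
      exact Finset.sum_eq_zero fun h _ => by rw [if_neg (fun hc => hta hc.1)]
  have e2 : ∑ l ∈ Finset.range (j' + 1), usage y T j' l t * (if l = a ∧ t = b then m else (0 : ℝ))
      = if t = b then usage y T j' a b * m else 0 := by
    by_cases htb : t = b
    · rw [if_pos htb]
      have e : ∀ l : ℕ, usage y T j' l t * (if l = a ∧ t = b then m else (0 : ℝ)) = if a = l then usage y T j' a b * m else 0 := by
        intro l
        by_cases hl : l = a
        · rw [if_pos ⟨hl, htb⟩, if_pos hl.symm, hl, htb]
        · rw [if_neg (fun hc => hl hc.1), if_neg (fun h => hl h.symm), mul_zero]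
      simp_rw [e]
      rw [Finset.sum_ite_eq (Finset.range (j' + 1)) a, if_pos (Finset.mem_range.2 (by omega))]
    · rw [if_neg htb]
      exact Finset.sum_eq_zero fun l _ => by rw [if_neg (fun hc => htb hc.2), mul_zero]
  rw [e1, e2]
  split_ifs <;> ring

/-- **regime (iii), `a` fits into `b`** (`2a < T < a + b`, `b ≤ j′ < c`, `usage(a,b)·A ≤ B`; floor `y·M ≤ T`): ship all of `a`
into `b`; the remainder `(Z, 0, B − usage·A, C)` has only the low `0`, and its first moment is at least `T` times its mass
because `usage(a,b)·(b − T) ≤ T − a` (`usage_mid_mul_le`) — NO further hypothesis. [this work] -/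
theorem fourAtom_decAt_mid_fits (y : ℝ) (j' M a b c : ℕ) (Z A B C : ℝ) (ha : 0 < a) (hab : a < b) (hbc : b < c)
    (hcM : c ≤ M) (hZ : 0 ≤ Z) (hA : 0 ≤ A) (hB : 0 ≤ B) (hC : 0 ≤ C) (hsum : Z + A + B + C = 1) (hy0 : 0 < y) (hy1 : y < 1)
    (hbj : b ≤ j') (hjc : j' < c) (h2a : 2 * (a : ℝ) < (a : ℝ) * A + (b : ℝ) * B + (c : ℝ) * C)
    (hcomp : (a : ℝ) * A + (b : ℝ) * B + (c : ℝ) * C < (a : ℝ) + b)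
    (hta : y * (M : ℝ) ≤ (a : ℝ) * A + (b : ℝ) * B + (c : ℝ) * C)
    (hfit : usage y ((a : ℝ) * A + (b : ℝ) * B + (c : ℝ) * C) j' a b * A ≤ B) :
    DECAt y j' M (fun h => QD[a, b, c, Z, A, B, C, h]) := by
  set T : ℝ := (a : ℝ) * A + (b : ℝ) * B + (c : ℝ) * C with hT
  set r : ℝ := usage y T j' a b with hr
  refine fourAtom_decAt_of_flow y j' M a b c Z A B C ha hab hbc hcM hZ hA hB hC hsum hy0 hy1 ?_
  have hT0 : 0 < T := lt_trans (by positivity) h2a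
  have hr0 : 0 < r := usage_pos_of_compat y T j' a b hy0 hy1 h2a hab (Or.inr hcomp)
  -- the remainder and its flow by the first-moment criterion
  obtain ⟨hR0, hRM, hR1, hRmean⟩ := QD_facts M a b c Z 0 (B - r * A) C ha hab hbc hcM hZ le_rfl (by linarith) hC
  have hmom : T * ∑ h ∈ Finset.range (M + 1), QD[a, b, c, Z, (0:ℝ), B - r * A, C, h]
      ≤ ∑ h ∈ Finset.range (M + 1), (h : ℝ) * QD[a, b, c, Z, (0:ℝ), B - r * A, C, h] := by
    rw [hR1, hRmean]
    have hrb : r * ((b : ℝ) - T) ≤ T - a := usage_mid_mul_le y T j' a b hy0 hy1 h2a hbj hcomp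
      (le_trans (mul_le_mul_of_nonneg_left (by exact_mod_cast (hbc.le.trans hcM)) hy0.le) hta)
    have hZ' : Z = 1 - A - B - C := by linarith
    rw [hZ']
    nlinarith [mul_nonneg hA (sub_nonneg.2 hrb)]
  have hFR := flowAtT_of_moment y T j' M (fun h => QD[a, b, c, Z, (0:ℝ), B - r * A, C, h]) hy0 hy1 hT0 hR0
    (fun l hl1 hlj hlow => by
      show QD[a, b, c, Z, (0:ℝ), B - r * A, C, l] = 0
      have hb' : (a : ℝ) < b := by exact_mod_cast hab
      have hlb : l ≠ b := by
        rintro rfl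
        linarith
      have hlc : l ≠ c := by rintro rfl; omega
      rw [if_neg (by omega), if_neg hlb, if_neg hlc]; ring)
    hta hmom
  obtain ⟨g, hg⟩ := (flowAtT_iff_exists_isFlowAtT _ _ _ _ _).1 hFR
  -- assemble: the single arc `(a, b)` carrying `A`, plus `g`
  have hφ0 : ∀ l h : ℕ, (0 : ℝ) ≤ (if l = a ∧ h = b then A else 0) := fun l h => by
    split_ifs; exacts [hA, le_rfl]
  have hφsupp : ∀ l h : ℕ, (0 : ℝ) < (if l = a ∧ h = b then A else 0) →
      l ≤ j' ∧ 2 * (l : ℝ) < T ∧ h ≤ M ∧ (j' + 1 ≤ h ∨ T < (l : ℝ) + h) := by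
    intro l h hp
    by_cases hc : l = a ∧ h = b
    · rw [hc.1, hc.2]; exact ⟨by omega, h2a, by omega, Or.inr hcomp⟩
    · rw [if_neg hc] at hp; exact absurd hp (lt_irrefl 0)
  have hg' : IsFlowAtT y T j' M (fun t => QD[a, b, c, Z, A, B, C, t]
      - ∑ h ∈ Finset.range (M + 1), (if t = a ∧ h = b then A else 0)
      - ∑ l ∈ Finset.range (j' + 1), usage y T j' l t * (if l = a ∧ t = b then A else 0)) g := by
    rw [fourAtom_partial_remainder y T j' M a b c Z A B C A (by omega) (by omega), sub_self]
    exact hg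
  exact (flowAtT_iff_exists_isFlowAtT _ _ _ _ _).2
    ⟨_, isFlowAtT_of_partial (φ := fun l h => if l = a ∧ h = b then A else 0) hφ0 hφsupp hg'⟩

/-- **regime (iii), `a` overflows `b`** (`2a < T < a + b`, `b ≤ j′ < c`, `usage(a,b)·A ≥ B`; C1 in the form
`y·(Z + A − B/usage) ≤ (1−y)·C`): `b` is filled by `a`, the overflow of `a` and all of `0` ride the giant `c`. [this work] -/
theorem fourAtom_decAt_mid_overflow (y : ℝ) (j' M a b c : ℕ) (Z A B C : ℝ) (ha : 0 < a) (hab : a < b) (hbc : b < c)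
    (hcM : c ≤ M) (hZ : 0 ≤ Z) (hA : 0 ≤ A) (hB : 0 ≤ B) (hC : 0 ≤ C) (hsum : Z + A + B + C = 1) (hy0 : 0 < y) (hy1 : y < 1)
    (hbj : b ≤ j') (hjc : j' < c) (h2a : 2 * (a : ℝ) < (a : ℝ) * A + (b : ℝ) * B + (c : ℝ) * C)
    (hcomp : (a : ℝ) * A + (b : ℝ) * B + (c : ℝ) * C < (a : ℝ) + b)
    (hover : B ≤ usage y ((a : ℝ) * A + (b : ℝ) * B + (c : ℝ) * C) j' a b * A)
    (hC1 : y * (Z + A - B / usage y ((a : ℝ) * A + (b : ℝ) * B + (c : ℝ) * C) j' a b) ≤ (1 - y) * C) :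
    DECAt y j' M (fun h => QD[a, b, c, Z, A, B, C, h]) := by
  set T : ℝ := (a : ℝ) * A + (b : ℝ) * B + (c : ℝ) * C with hT
  set r : ℝ := usage y T j' a b with hr
  refine fourAtom_decAt_of_flow y j' M a b c Z A B C ha hab hbc hcM hZ hA hB hC hsum hy0 hy1 ?_
  have hr0 : 0 < r := usage_pos_of_compat y T j' a b hy0 hy1 h2a hab (Or.inr hcomp)
  have h1y : 0 < 1 - y := by linarith
  have hm0 : 0 ≤ B / r := div_nonneg hB hr0.le
  have hAm : 0 ≤ A - B / r := by rw [sub_nonneg, div_le_iff₀ hr0]; linarith [mul_comm r A]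
  have hBm : B - r * (B / r) = 0 := by field_simp; ring
  -- the remainder `(Z, A − B/r, 0, C)` rides the giant
  obtain ⟨hR0, -, -, -⟩ := QD_facts M a b c Z (A - B / r) 0 C ha hab hbc hcM hZ hAm le_rfl hC
  have hFR : FlowAtT y T j' M (fun h => QD[a, b, c, Z, A - B / r, (0:ℝ), C, h]) := by
    refine flowAtT_of_giants y T j' M _ hy0 hy1 hR0 ?_
    have hlow : ∑ l ∈ Finset.range (j' + 1), (if 2 * (l : ℝ) < T then QD[a, b, c, Z, A - B / r, (0:ℝ), C, l] else 0)
        ≤ Z + (A - B / r) := by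
      have e : ∀ l : ℕ, (if 2 * (l : ℝ) < T then QD[a, b, c, Z, A - B / r, (0:ℝ), C, l] else 0)
          = (if 2 * (l : ℝ) < T then (1 : ℝ) else 0) * QD[a, b, c, Z, A - B / r, (0:ℝ), C, l] := by
        intro l; split_ifs <;> ring
      simp_rw [e]
      rw [sum_mul_QD _ _ a b c Z (A - B / r) 0 C, if_pos (show (0 : ℕ) ∈ Finset.range (j' + 1) from Finset.mem_range.2 (Nat.succ_pos j')),
        if_pos (show a ∈ Finset.range (j' + 1) from Finset.mem_range.2 (by omega)),
        if_pos (show b ∈ Finset.range (j' + 1) from Finset.mem_range.2 (by omega)),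
        if_neg (show c ∉ Finset.range (j' + 1) by rw [Finset.mem_range]; omega), add_zero]
      have : (if 2 * ((b : ℕ) : ℝ) < T then (1:ℝ) else 0) * 0 = 0 := mul_zero _
      rw [this, add_zero]
      refine add_le_add ?_ ?_ <;> split_ifs <;> linarith
    have hgiant : C ≤ ∑ h ∈ Finset.Ico (j' + 1) (M + 1), QD[a, b, c, Z, A - B / r, (0:ℝ), C, h] := by
      have := sum_mul_QD (Finset.Ico (j' + 1) (M + 1)) (fun _ => (1 : ℝ)) a b c Z (A - B / r) 0 C
      simp only [one_mul] at this
      rw [this, if_neg (show (0 : ℕ) ∉ Finset.Ico (j' + 1) (M + 1) by simp),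
        if_neg (show a ∉ Finset.Ico (j' + 1) (M + 1) by rw [Finset.mem_Ico]; omega),
        if_neg (show b ∉ Finset.Ico (j' + 1) (M + 1) by rw [Finset.mem_Ico]; omega),
        if_pos (show c ∈ Finset.Ico (j' + 1) (M + 1) from Finset.mem_Ico.2 ⟨by omega, by omega⟩)]
      linarith
    have hux : 0 < y / (1 - y) := div_pos hy0 h1y
    have key : y / (1 - y) * (Z + (A - B / r)) ≤ C := by
      rw [div_mul_eq_mul_div, div_le_iff₀ h1y]
      have : y * (Z + (A - B / r)) = y * (Z + A - B / r) := by ring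
      rw [this]; linarith
    calc y / (1 - y) * ∑ l ∈ Finset.range (j' + 1), (if 2 * (l : ℝ) < T then QD[a, b, c, Z, A - B / r, (0:ℝ), C, l] else 0)
        ≤ y / (1 - y) * (Z + (A - B / r)) := mul_le_mul_of_nonneg_left hlow hux.le
      _ ≤ C := key
      _ ≤ _ := hgiant
  obtain ⟨g, hg⟩ := (flowAtT_iff_exists_isFlowAtT _ _ _ _ _).1 hFR
  have hφ0 : ∀ l h : ℕ, (0 : ℝ) ≤ (if l = a ∧ h = b then B / r else 0) := fun l h => by
    split_ifs; exacts [hm0, le_rfl]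
  have hφsupp : ∀ l h : ℕ, (0 : ℝ) < (if l = a ∧ h = b then B / r else 0) →
      l ≤ j' ∧ 2 * (l : ℝ) < T ∧ h ≤ M ∧ (j' + 1 ≤ h ∨ T < (l : ℝ) + h) := by
    intro l h hp
    by_cases hc : l = a ∧ h = b
    · rw [hc.1, hc.2]; exact ⟨by omega, h2a, by omega, Or.inr hcomp⟩
    · rw [if_neg hc] at hp; exact absurd hp (lt_irrefl 0)
  have hg' : IsFlowAtT y T j' M (fun t => QD[a, b, c, Z, A, B, C, t]
      - ∑ h ∈ Finset.range (M + 1), (if t = a ∧ h = b then B / r else 0)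
      - ∑ l ∈ Finset.range (j' + 1), usage y T j' l t * (if l = a ∧ t = b then B / r else 0)) g := by
    rw [fourAtom_partial_remainder y T j' M a b c Z A B C (B / r) (by omega) (by omega), ← hr, hBm]
    exact hg
  exact (flowAtT_iff_exists_isFlowAtT _ _ _ _ _).2
    ⟨_, isFlowAtT_of_partial (φ := fun l h => if l = a ∧ h = b then B / r else 0) hφ0 hφsupp hg'⟩

/-! ### All layers, by regime -/

/-- **ONE-LOW CASE `2a ≥ T`**: every nonzero atom is self-sufficient at every layer; with `y·M ≤ T` the first-moment criterion
gives DEC at every layer `j′ < M`. [this work] -/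
theorem fourAtom_decAt_of_bigLow (y : ℝ) (M a b c : ℕ) (Z A B C : ℝ) (ha : 0 < a) (hab : a < b) (hbc : b < c)
    (hcM : c ≤ M) (hZ : 0 ≤ Z) (hA : 0 ≤ A) (hB : 0 ≤ B) (hC : 0 ≤ C) (hsum : Z + A + B + C = 1) (hy0 : 0 < y) (hy1 : y < 1)
    (hta : y * (M : ℝ) ≤ (a : ℝ) * A + (b : ℝ) * B + (c : ℝ) * C)
    (h2a : (a : ℝ) * A + (b : ℝ) * B + (c : ℝ) * C ≤ 2 * (a : ℝ)) :
    ∀ j', j' < M → DECAt y j' M (fun h => QD[a, b, c, Z, A, B, C, h]) := by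
  intro j' hj'
  obtain ⟨hL0, hLM, hL1, hmean⟩ := QD_laws M a b c Z A B C ha hab hbc hcM hZ hA hB hC hsum
  set T : ℝ := (a : ℝ) * A + (b : ℝ) * B + (c : ℝ) * C with hT
  have hT0 : 0 < T := by
    have hM0 : (1 : ℝ) ≤ M := by exact_mod_cast (show 1 ≤ M by omega)
    nlinarith
  refine fourAtom_decAt_of_flow y j' M a b c Z A B C ha hab hbc hcM hZ hA hB hC hsum hy0 hy1
    (flowAtT_of_moment y T j' M _ hy0 hy1 hT0 hL0 (fun l hl1 hlj hlow => ?_) hta (by rw [hL1, hmean, mul_one]))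
  -- a nonzero low atom carries no mass: `a, b, c` are not low
  have ha' : (a : ℝ) < b := by exact_mod_cast hab
  have hb' : (b : ℝ) < c := by exact_mod_cast hbc
  have hla : l ≠ a := by rintro rfl; linarith
  have hlb : l ≠ b := by rintro rfl; linarith
  have hlc : l ≠ c := by rintro rfl; linarith
  show QD[a, b, c, Z, A, B, C, l] = 0
  rw [if_neg (by omega), if_neg hla, if_neg hlb, if_neg hlc]; ring

/-- **H2 (`y ≤ C`) gives DEC at every layer `j′ < M`** (`y·M ≤ T`; this is the binding inequality in regime (i) `2b < T`, and a
sufficient one in every regime). [this work] -/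
theorem fourAtom_decAt_all_of_threeLows (y : ℝ) (M a b c : ℕ) (Z A B C : ℝ) (ha : 0 < a) (hab : a < b) (hbc : b < c)
    (hcM : c ≤ M) (hZ : 0 ≤ Z) (hA : 0 ≤ A) (hB : 0 ≤ B) (hC : 0 ≤ C) (hsum : Z + A + B + C = 1) (hy0 : 0 < y) (hy1 : y < 1)
    (hta : y * (M : ℝ) ≤ (a : ℝ) * A + (b : ℝ) * B + (c : ℝ) * C) (hH2 : y ≤ C) :
    ∀ j', j' < M → DECAt y j' M (fun h => QD[a, b, c, Z, A, B, C, h]) := by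
  intro j' hj'
  have htac : y * (c : ℝ) ≤ (a : ℝ) * A + (b : ℝ) * B + (c : ℝ) * C :=
    le_trans (mul_le_mul_of_nonneg_left (by exact_mod_cast hcM) hy0.le) hta
  by_cases hjb : j' < b
  · exact fourAtom_decAt_below y j' M a b c Z A B C ha hab hbc hcM hZ hA hB hC hsum hy0 hy1 hjb (by linarith)
  by_cases hjc : j' < c
  · exact fourAtom_decAt_mid_threeLows y j' M a b c Z A B C ha hab hbc hcM hZ hA hB hC hsum hy0 hy1 (not_lt.1 hjb) hjc hH2
  · exact fourAtom_decAt_top y j' M a b c Z A B C ha hab hbc hcM hZ hA hB hC hsum hy1 htac (not_lt.1 hjc)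

/-- **REGIME (ii) `T ≤ 2b`, H3 (`y(Z + A) ≤ (1−y)C`)**: DEC at every layer `j′ < M` (`y·M ≤ T`).  (Used when `a + b ≤ T`, where H3
is also necessary; the flows themselves only need `T ≤ 2b`.) [this work] -/
theorem fourAtom_decAt_all_of_incompatible (y : ℝ) (M a b c : ℕ) (Z A B C : ℝ) (ha : 0 < a) (hab : a < b) (hbc : b < c)
    (hcM : c ≤ M) (hZ : 0 ≤ Z) (hA : 0 ≤ A) (hB : 0 ≤ B) (hC : 0 ≤ C) (hsum : Z + A + B + C = 1) (hy0 : 0 < y) (hy1 : y < 1)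
    (hta : y * (M : ℝ) ≤ (a : ℝ) * A + (b : ℝ) * B + (c : ℝ) * C)
    (h2b : (a : ℝ) * A + (b : ℝ) * B + (c : ℝ) * C ≤ 2 * (b : ℝ)) (hH3 : y * (Z + A) ≤ (1 - y) * C) :
    ∀ j', j' < M → DECAt y j' M (fun h => QD[a, b, c, Z, A, B, C, h]) := by
  intro j' hj'
  have htac : y * (c : ℝ) ≤ (a : ℝ) * A + (b : ℝ) * B + (c : ℝ) * C :=
    le_trans (mul_le_mul_of_nonneg_left (by exact_mod_cast hcM) hy0.le) hta
  have hH1 : y ≤ B + C := by nlinarith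
  by_cases hjb : j' < b
  · exact fourAtom_decAt_below y j' M a b c Z A B C ha hab hbc hcM hZ hA hB hC hsum hy0 hy1 hjb hH1
  by_cases hjc : j' < c
  · exact fourAtom_decAt_mid_incompatible y j' M a b c Z A B C ha hab hbc hcM hZ hA hB hC hsum hy0 hy1 (not_lt.1 hjb) hjc
      h2b hH3
  · exact fourAtom_decAt_top y j' M a b c Z A B C ha hab hbc hcM hZ hA hB hC hsum hy1 htac (not_lt.1 hjc)


/-- **REGIME (iii) `2a < T < a + b` (the corner)**: H1 (`y ≤ B + C`) and C1 (`y·(Z + A − B/usage(a,b)) ≤ (1−y)·C`, usage at any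
layer `≥ b`) give DEC at every layer `j′ < M` (`y·M ≤ T`). [this work] -/
theorem fourAtom_decAt_all_of_corner (y : ℝ) (M a b c : ℕ) (Z A B C : ℝ) (ha : 0 < a) (hab : a < b) (hbc : b < c)
    (hcM : c ≤ M) (hZ : 0 ≤ Z) (hA : 0 ≤ A) (hB : 0 ≤ B) (hC : 0 ≤ C) (hsum : Z + A + B + C = 1) (hy0 : 0 < y) (hy1 : y < 1)
    (hta : y * (M : ℝ) ≤ (a : ℝ) * A + (b : ℝ) * B + (c : ℝ) * C)
    (h2a : 2 * (a : ℝ) < (a : ℝ) * A + (b : ℝ) * B + (c : ℝ) * C)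
    (hcomp : (a : ℝ) * A + (b : ℝ) * B + (c : ℝ) * C < (a : ℝ) + b) (hH1 : y ≤ B + C)
    (hC1 : y * (Z + A - B / usage y ((a : ℝ) * A + (b : ℝ) * B + (c : ℝ) * C) b a b) ≤ (1 - y) * C) :
    ∀ j', j' < M → DECAt y j' M (fun h => QD[a, b, c, Z, A, B, C, h]) := by
  intro j' hj'
  have htac : y * (c : ℝ) ≤ (a : ℝ) * A + (b : ℝ) * B + (c : ℝ) * C :=
    le_trans (mul_le_mul_of_nonneg_left (by exact_mod_cast hcM) hy0.le) hta
  by_cases hjb : j' < b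
  · exact fourAtom_decAt_below y j' M a b c Z A B C ha hab hbc hcM hZ hA hB hC hsum hy0 hy1 hjb hH1
  by_cases hjc : j' < c
  · have hbj : b ≤ j' := not_lt.1 hjb
    rw [usage_of_le_layers y _ b j' a b le_rfl hbj] at hC1
    by_cases hfit : usage y ((a : ℝ) * A + (b : ℝ) * B + (c : ℝ) * C) j' a b * A ≤ B
    · exact fourAtom_decAt_mid_fits y j' M a b c Z A B C ha hab hbc hcM hZ hA hB hC hsum hy0 hy1 hbj hjc h2a hcomp hta hfit
    · exact fourAtom_decAt_mid_overflow y j' M a b c Z A B C ha hab hbc hcM hZ hA hB hC hsum hy0 hy1 hbj hjc h2a hcomp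
        (le_of_lt (not_le.1 hfit)) hC1
  · exact fourAtom_decAt_top y j' M a b c Z A B C ha hab hbc hcM hZ hA hB hC hsum hy1 htac (not_lt.1 hjc)

end LawDec

end Quant

end Summit.CriticalPhenomena.PercolationContinuityZ3.Theorems
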